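import Literature.NumberTheory.Sieve.SmoothSaddlePointApprox
import Mathlib.Analysis.Calculus.Deriv.MeanValue
import HarnessLib

/-!
# The second derivative `φ₂(σ, y)` of `log ζ(σ, y)`: convexity of `-φ₁`, `φ₂(α, y) ≍ log x · log y`

Topic `NumberTheory/Sieve` (smooth numbers); companion of `SmoothSaddlePoint.lean` (`smoothZeta`,
`saddleSum = -φ₁`, `saddlePoint = α(x, y)`) and `SmoothSaddlePointApprox.lean` (`y^{1-α} ≍ u log(u+1)`).
One definition, `saddlePhi₂ σ y = φ₂(σ, y) = Σ_{p ≤ y} log² p · p^σ/(p^σ - 1)²`, Hildebrand–Tenenbaum's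
second derivative of `φ(s, y) = log ζ(s, y)` at a real point [HildebrandTenenbaum1986, §2–§3], the
quantity entering the saddle-point estimate `Ψ(x, y) ≈ x^α ζ(α, y)/(α √(2π φ₂(α, y)))` (Thm 1 (2.3));
everything else is PROVED:

* `hasDerivAt_saddleSum` — `(d/dσ)(-φ₁(σ, y)) = -φ₂(σ, y)` (`σ > 0`);
* `saddlePhi₂_antitoneOn`, `saddleSum_sub_mul_le` — `φ₂` decreases in `σ`, so `-φ₁` is convex:
  `-φ₁(σ) ≥ -φ₁(σ₀) - φ₂(σ₀)(σ - σ₀)` (the tangent inequality used to compare `α(x/d, y)` with `α(x, y)`);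
* `saddlePhi₂_le_mul_saddleSum` (`φ₂ ≤ 3 log y · (-φ₁)`, `σ ≥ 3/5`), `sum_log_sq_mul_rpow_le_saddlePhi₂`
  (`Σ log² p · p^{-σ} ≤ φ₂`), `saddlePhi₂_le_rpow_mul` (`φ₂(σ) ≤ 9 y^{σ'-σ} φ₂(σ')`, `3/5 ≤ σ ≤ σ'`);
* `three_fifths_le_saddlePoint` — `α(x, y) ≥ 3/5` for `(log x)^3 ≤ y ≤ x`, `x ≥ x₀`;
* `saddlePhi₂_saddlePoint_le`, `le_saddlePhi₂_saddlePoint` — **`φ₂(α(x,y), y) ≍ log x · log y`** in the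
  range `(log x)^3 ≤ y ≤ x`, `x ≥ x₀`: Hildebrand–Tenenbaum's (2.5) "`φ₂(α, y) = (1 + (log x)/y) log x
  log y (1 + O(1/log(1+u) + 1/log y))`" / Lemma 4 (3.8) (`k = 2`) up to absolute constants.

## The argument

Upper bound: termwise `p^σ/(p^σ - 1) ≤ 3` and `log p ≤ log y`, then `-φ₁(α, y) = log x`. Lower bound:
`φ₂(α, y) ≥ Σ_{√y < p ≤ y} log² p · p^{-α} ≥ ½ log y · Σ_{√y < p ≤ y} log p · p^{-α}`; partial summation on
`[√y, y]` (`exists_sum_primesLE_log_mul_rpow_sub_ge`, Chebyshev's `θ`) bounds the last sum below by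
`(log 2/2) α ∫_{√y}^y t^{-α} dt - log 4 · y^{(1-α)/2} - c₁`, and `∫_{√y}^y t^{-α} dt` is
`≥ ¾ y^{1-α} log y/log(y^{1-α}) ≫ u log y` when `y^{1-α} ≥ 16` (by `y^{1-α} ≍ u log(u+1)`), and
`≥ e^{-4} log √y` when `y^{1-α} < 16` (then `u ≪ 1` and `α ≤ 1 + 4/log y`).

NOT here: `φ_k` for `k ≥ 3`, complex `s`, the `1 + o(1)` forms of (2.5).

## References

* [HildebrandTenenbaum1986] A. Hildebrand, G. Tenenbaum, Trans. AMS 296 (1986) 265–290: §2 (2.3), Thm 2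
  (2.5); §3 Lemma 4 (3.8) (held: `paper:doi-10-1090-s0002-9947-1986-0837811-1`, pp. 267–268, 273).
* [Harper2016] A. J. Harper, Compositio Math. 152 (2016), §2.1 (Smooth Numbers Results 1–2).
-/

noncomputable section

open Real Filter Finset MeasureTheory Chebyshev

namespace Literature.NumberTheory.Sieve

variable {σ σ' : ℝ} {y : ℕ} {p : ℕ}

/-! ### `φ₂(σ, y)` -/

/-- `φ₂(σ, y) = Σ_{p ≤ y} log² p · p^σ/(p^σ - 1)²`, the second `σ`-derivative of `log ζ(σ, y)`
(`= -(d/dσ) Σ_{p ≤ y} log p/(p^σ - 1)`, `hasDerivAt_saddleSum`), Hildebrand–Tenenbaum's `φ₂(s, y)` at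
a real point; `1/√(2π φ₂(α, y))` is the Gaussian factor of the saddle-point estimate for `Ψ(x, y)`.
[cite: HildebrandTenenbaum1986, §2 (definition of φ_k) and Thm 1 (2.3)] -/
def saddlePhi₂ (σ : ℝ) (y : ℕ) : ℝ :=
  ∑ p ∈ Nat.primesLE y, Real.log p ^ 2 * ((p : ℝ) ^ σ / ((p : ℝ) ^ σ - 1) ^ 2)

/-- Unfolding lemma for `saddlePhi₂`. [folklore] -/
theorem saddlePhi₂_def (σ : ℝ) (y : ℕ) :
    saddlePhi₂ σ y = ∑ p ∈ Nat.primesLE y, Real.log p ^ 2 * ((p : ℝ) ^ σ / ((p : ℝ) ^ σ - 1) ^ 2) :=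
  rfl

/-- Members of `primesLE y` are at least `2`. [folklore] -/
private theorem two_le_of_mem' (hp : p ∈ Nat.primesLE y) : (2 : ℝ) ≤ p := by
  exact_mod_cast (Nat.mem_primesLE.1 hp).2.two_le

/-- Each term of `φ₂(σ, y)` is positive for `σ > 0`. [folklore] -/
theorem saddlePhi₂_term_pos (hp : p ∈ Nat.primesLE y) (hσ : 0 < σ) :
    0 < Real.log p ^ 2 * ((p : ℝ) ^ σ / ((p : ℝ) ^ σ - 1) ^ 2) := by
  have hp2 := two_le_of_mem' hp
  have hlog : 0 < Real.log p := Real.log_pos (by linarith)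
  have hpσ : 1 < (p : ℝ) ^ σ := Real.one_lt_rpow (by linarith) hσ
  have h1 : 0 < ((p : ℝ) ^ σ - 1) ^ 2 := by positivity
  positivity

/-- `φ₂(σ, y) ≥ 0` (every `σ`). [folklore] -/
theorem saddlePhi₂_nonneg (σ : ℝ) (y : ℕ) : 0 ≤ saddlePhi₂ σ y := by
  refine Finset.sum_nonneg fun p hp => ?_
  have hp2 := two_le_of_mem' hp
  have : 0 ≤ (p : ℝ) ^ σ := Real.rpow_nonneg (by linarith) _
  positivity

/-- `φ₂(σ, y) > 0` for `σ > 0`, `y ≥ 2`. [cite: HildebrandTenenbaum1986, §2 (after (2.3))] -/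
theorem saddlePhi₂_pos (hy : 2 ≤ y) (hσ : 0 < σ) : 0 < saddlePhi₂ σ y := by
  have h2 : 2 ∈ Nat.primesLE y := Nat.mem_primesLE.2 ⟨hy, Nat.prime_two⟩
  exact Finset.sum_pos' (fun p hp => (saddlePhi₂_term_pos hp hσ).le)
    ⟨2, h2, saddlePhi₂_term_pos h2 hσ⟩

/-! ### `-φ₁' = -φ₂`: derivative, monotonicity, convexity -/

/-- **`(d/dσ)(-φ₁(σ, y)) = -φ₂(σ, y)`**: `σ ↦ Σ_{p ≤ y} log p/(p^σ - 1)` has derivative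
`-Σ_{p ≤ y} log² p · p^σ/(p^σ - 1)²` at every `σ > 0`.
[cite: HildebrandTenenbaum1986, §2 (definition of φ_k)] -/
theorem hasDerivAt_saddleSum (hσ : 0 < σ) :
    HasDerivAt (fun s : ℝ => saddleSum s y) (-saddlePhi₂ σ y) σ := by
  have hterm : ∀ p ∈ Nat.primesLE y, HasDerivAt (fun s : ℝ => Real.log p / ((p : ℝ) ^ s - 1))
      (-(Real.log p ^ 2 * ((p : ℝ) ^ σ / ((p : ℝ) ^ σ - 1) ^ 2))) σ := by
    intro p hp
    have hp2 := two_le_of_mem' hp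
    have hp0 : (0 : ℝ) < p := by linarith
    have hpσ : 1 < (p : ℝ) ^ σ := Real.one_lt_rpow (by linarith) hσ
    have hne : (p : ℝ) ^ σ - 1 ≠ 0 := by linarith
    -- `s ↦ p^s` has derivative `log p · p^σ`
    have h1 : HasDerivAt (fun s : ℝ => (p : ℝ) ^ s) (Real.log p * 1 * (p : ℝ) ^ σ) σ :=
      (hasDerivAt_id σ).const_rpow hp0
    have h2 : HasDerivAt (fun s : ℝ => (p : ℝ) ^ s - 1) (Real.log p * 1 * (p : ℝ) ^ σ) σ :=
      h1.sub_const 1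
    have h3 := (h2.inv hne).const_mul (Real.log p)
    refine h3.congr_deriv ?_
    field_simp
  simpa [saddleSum, saddlePhi₂, Finset.sum_neg_distrib] using HasDerivAt.fun_sum hterm

/-- `a/(a-1)²` is decreasing in `a > 1`: for `1 < a ≤ b`, `b/(b-1)² ≤ a/(a-1)²`. [folklore] -/
theorem div_sub_one_sq_antitone {a b : ℝ} (ha : 1 < a) (hab : a ≤ b) :
    b / (b - 1) ^ 2 ≤ a / (a - 1) ^ 2 := by
  have hb : 1 < b := lt_of_lt_of_le ha hab
  rw [div_le_div_iff₀ (by positivity) (by positivity)]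
  -- `b (a-1)² ≤ a (b-1)²  ⟺  (b - a)(ab - 1) ≥ 0`
  have h1 : 0 ≤ (b - a) * (a * b - 1) := mul_nonneg (by linarith) (by nlinarith)
  nlinarith

/-- **`φ₂(σ, y)` is decreasing in `σ > 0`** (termwise: `p^σ` increases, `a/(a-1)²` decreases); hence
`-φ₁(σ, y)` is convex. [folklore] -/
theorem saddlePhi₂_antitoneOn : AntitoneOn (fun σ : ℝ => saddlePhi₂ σ y) (Set.Ioi 0) := by
  intro σ hσ σ' _ hle
  simp only [saddlePhi₂]
  refine Finset.sum_le_sum fun p hp => ?_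
  have hp2 := two_le_of_mem' hp
  have hlog2 : 0 ≤ Real.log p ^ 2 := sq_nonneg _
  refine mul_le_mul_of_nonneg_left ?_ hlog2
  have hpσ : 1 < (p : ℝ) ^ σ := Real.one_lt_rpow (by linarith) hσ
  exact div_sub_one_sq_antitone hpσ (Real.rpow_le_rpow_of_exponent_le (by linarith) hle)

/-- **Tangent inequality (convexity of `-φ₁`)**: `-φ₁(σ, y) ≥ -φ₁(σ₀, y) - φ₂(σ₀, y)(σ - σ₀)` for all
`σ, σ₀ > 0` (mean value theorem and the monotonicity of `φ₂`). [folklore] -/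
theorem saddleSum_sub_mul_le {σ₀ : ℝ} (hσ₀ : 0 < σ₀) (hσ : 0 < σ) :
    saddleSum σ₀ y - saddlePhi₂ σ₀ y * (σ - σ₀) ≤ saddleSum σ y := by
  rcases lt_trichotomy σ₀ σ with hlt | rfl | hgt
  · -- MVT on `[σ₀, σ]`: `s(σ) - s(σ₀) = -φ₂(ξ)(σ - σ₀) ≥ -φ₂(σ₀)(σ - σ₀)`
    obtain ⟨ξ, hξ, hslope⟩ := exists_hasDerivAt_eq_slope (fun s : ℝ => saddleSum s y)
      (fun s => -saddlePhi₂ s y) hlt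
      (fun s hs =>
        (hasDerivAt_saddleSum (y := y) (lt_of_lt_of_le hσ₀ hs.1)).continuousAt.continuousWithinAt)
      (fun s hs => hasDerivAt_saddleSum (lt_trans hσ₀ hs.1))
    have hξ0 : 0 < ξ := lt_trans hσ₀ hξ.1
    have hφ : saddlePhi₂ ξ y ≤ saddlePhi₂ σ₀ y := saddlePhi₂_antitoneOn hσ₀ hξ0 hξ.1.le
    have heq : saddleSum σ y - saddleSum σ₀ y = -saddlePhi₂ ξ y * (σ - σ₀) := by
      rw [hslope]; field_simp
    nlinarith [heq, hφ, hlt]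
  · simp
  · -- MVT on `[σ, σ₀]`
    obtain ⟨ξ, hξ, hslope⟩ := exists_hasDerivAt_eq_slope (fun s : ℝ => saddleSum s y)
      (fun s => -saddlePhi₂ s y) hgt
      (fun s hs =>
        (hasDerivAt_saddleSum (y := y) (lt_of_lt_of_le hσ hs.1)).continuousAt.continuousWithinAt)
      (fun s hs => hasDerivAt_saddleSum (lt_trans hσ hs.1))
    have hξ0 : 0 < ξ := lt_trans hσ hξ.1
    have hφ : saddlePhi₂ σ₀ y ≤ saddlePhi₂ ξ y := saddlePhi₂_antitoneOn hξ0 hσ₀ hξ.2.le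
    have heq : saddleSum σ₀ y - saddleSum σ y = -saddlePhi₂ ξ y * (σ₀ - σ) := by
      rw [hslope]; field_simp
    nlinarith [heq, hφ, hgt]

/-! ### Elementary comparisons -/

/-- `φ₂(σ, y) ≤ 3 log y · (-φ₁(σ, y))` for `σ ≥ 3/5` (termwise `log p ≤ log y` and `p^σ/(p^σ - 1) ≤ 3` as
`p^σ ≥ 2^{3/5} ≥ 3/2`). [cite: HildebrandTenenbaum1986, Lemma 4 (3.8), proof] -/
theorem saddlePhi₂_le_mul_saddleSum (hσ : 3 / 5 ≤ σ) (y : ℕ) :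
    saddlePhi₂ σ y ≤ 3 * Real.log y * saddleSum σ y := by
  have hσ0 : 0 < σ := by linarith
  rw [saddlePhi₂, saddleSum, Finset.mul_sum]
  refine Finset.sum_le_sum fun p hp => ?_
  obtain ⟨hpy, hpp⟩ := Nat.mem_primesLE.1 hp
  have hp2 := two_le_of_mem' hp
  have hp0 : (0 : ℝ) < p := by linarith
  have hlog0 : 0 ≤ Real.log p := Real.log_nonneg (by linarith)
  have hlogy : Real.log p ≤ Real.log y := Real.log_le_log hp0 (by exact_mod_cast hpy)
  set P : ℝ := (p : ℝ) ^ σ with hP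
  have hP32 : (3 / 2 : ℝ) ≤ P := by
    calc (3 / 2 : ℝ) ≤ (2 : ℝ) ^ (3 / 5 : ℝ) := three_halves_le_two_rpow
      _ ≤ (2 : ℝ) ^ σ := Real.rpow_le_rpow_of_exponent_le one_le_two hσ
      _ ≤ (p : ℝ) ^ σ := Real.rpow_le_rpow (by norm_num) hp2 hσ0.le
  have hP1 : 0 < P - 1 := by linarith
  -- `P/(P-1)² ≤ 3/(P-1)`
  have hkey : P / (P - 1) ^ 2 ≤ 3 / (P - 1) := by
    rw [div_le_div_iff₀ (by positivity) hP1]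
    nlinarith
  calc Real.log p ^ 2 * (P / (P - 1) ^ 2) ≤ (Real.log y * Real.log p) * (3 / (P - 1)) := by
        refine mul_le_mul ?_ hkey (by positivity) (by positivity)
        rw [sq]; exact mul_le_mul_of_nonneg_right hlogy hlog0
    _ = 3 * Real.log y * (Real.log p / (P - 1)) := by ring

/-- `Σ_{p ≤ y} log² p · p^{-σ} ≤ φ₂(σ, y)` for `σ > 0` (termwise `p^{-σ} ≤ p^σ/(p^σ - 1)²`). [folklore] -/
theorem sum_log_sq_mul_rpow_le_saddlePhi₂ (hσ : 0 < σ) (y : ℕ) :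
    ∑ p ∈ Nat.primesLE y, Real.log p ^ 2 * (p : ℝ) ^ (-σ) ≤ saddlePhi₂ σ y := by
  rw [saddlePhi₂]
  refine Finset.sum_le_sum fun p hp => ?_
  have hp2 := two_le_of_mem' hp
  have hp0 : (0 : ℝ) < p := by linarith
  refine mul_le_mul_of_nonneg_left ?_ (sq_nonneg _)
  have hpσ : 1 < (p : ℝ) ^ σ := Real.one_lt_rpow (by linarith) hσ
  set P : ℝ := (p : ℝ) ^ σ with hP
  rw [Real.rpow_neg hp0.le, ← hP, inv_eq_one_div, div_le_div_iff₀ (by linarith) (by nlinarith)]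
  nlinarith

/-- **Two-point comparison**: `φ₂(σ, y) ≤ 9 y^{σ' - σ} φ₂(σ', y)` for `3/5 ≤ σ ≤ σ'`, `y ≥ 1` (termwise,
with `a = p^σ ≥ 3/2`, `b = p^{σ'}`: `(b-1)/(a-1) ≤ 3b/a`, so `a/(a-1)² ≤ 9 (b/a) · b/(b-1)²`, and
`b/a = p^{σ'-σ} ≤ y^{σ'-σ}`). [folklore] -/
theorem saddlePhi₂_le_rpow_mul (hσ : 3 / 5 ≤ σ) (hle : σ ≤ σ') (hy : 1 ≤ y) :
    saddlePhi₂ σ y ≤ 9 * (y : ℝ) ^ (σ' - σ) * saddlePhi₂ σ' y := by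
  have hσ0 : 0 < σ := by linarith
  have hy1 : (1 : ℝ) ≤ y := by exact_mod_cast hy
  rw [saddlePhi₂, saddlePhi₂, Finset.mul_sum]
  refine Finset.sum_le_sum fun p hp => ?_
  obtain ⟨hpy, hpp⟩ := Nat.mem_primesLE.1 hp
  have hp2 := two_le_of_mem' hp
  have hp0 : (0 : ℝ) < p := by linarith
  set a : ℝ := (p : ℝ) ^ σ with ha
  set b : ℝ := (p : ℝ) ^ σ' with hb
  have ha32 : (3 / 2 : ℝ) ≤ a := by
    calc (3 / 2 : ℝ) ≤ (2 : ℝ) ^ (3 / 5 : ℝ) := three_halves_le_two_rpow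
      _ ≤ (2 : ℝ) ^ σ := Real.rpow_le_rpow_of_exponent_le one_le_two hσ
      _ ≤ (p : ℝ) ^ σ := Real.rpow_le_rpow (by norm_num) hp2 hσ0.le
  have hab : a ≤ b := Real.rpow_le_rpow_of_exponent_le (by linarith) hle
  have ha0 : 0 < a := by linarith
  have ha1 : 0 < a - 1 := by linarith
  have hb1 : 0 < b - 1 := by linarith
  have hb0 : 0 < b := by linarith
  have hratio : b / a = (p : ℝ) ^ (σ' - σ) := by
    rw [ha, hb, Real.rpow_sub hp0]
  have hratio_le : (p : ℝ) ^ (σ' - σ) ≤ (y : ℝ) ^ (σ' - σ) :=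
    Real.rpow_le_rpow hp0.le (by exact_mod_cast hpy) (by linarith)
  -- termwise inequality `a/(a-1)² ≤ 9 (b/a) b/(b-1)²`
  have hkey : a / (a - 1) ^ 2 ≤ 9 * (b / a) * (b / (b - 1) ^ 2) := by
    rw [show 9 * (b / a) * (b / (b - 1) ^ 2) = 9 * b ^ 2 / (a * (b - 1) ^ 2) by
      field_simp]
    rw [div_le_div_iff₀ (pow_pos ha1 2) (mul_pos ha0 (pow_pos hb1 2))]
    -- `a · a (b-1)² ≤ 9 b² (a-1)²`, from `a (b - 1) ≤ 3 b (a - 1)` (as `2a ≥ 3`)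
    have h1 : a * (b - 1) ≤ 3 * b * (a - 1) := by nlinarith
    have h2 : 0 ≤ a * (b - 1) := mul_nonneg ha0.le hb1.le
    have h3 : 0 ≤ 3 * b * (a - 1) := mul_nonneg (mul_nonneg (by norm_num) hb0.le) ha1.le
    nlinarith [mul_le_mul h1 h1 h2 h3]
  calc Real.log p ^ 2 * (a / (a - 1) ^ 2) ≤ Real.log p ^ 2 * (9 * (b / a) * (b / (b - 1) ^ 2)) :=
        mul_le_mul_of_nonneg_left hkey (sq_nonneg _)
    _ = 9 * (p : ℝ) ^ (σ' - σ) * (Real.log p ^ 2 * (b / (b - 1) ^ 2)) := by rw [← hratio]; ring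
    _ ≤ 9 * (y : ℝ) ^ (σ' - σ) * (Real.log p ^ 2 * (b / (b - 1) ^ 2)) := by
        refine mul_le_mul_of_nonneg_right (mul_le_mul_of_nonneg_left hratio_le (by norm_num)) ?_
        have : 0 ≤ b := by positivity
        positivity


/-! ### Partial summation on `[z, y]` -/

/-- **Lower bound by partial summation on `[z, y]`**: with `c₁` from Chebyshev's lower bound,
`Σ_{z < p ≤ y} log p · p^{-σ} ≥ (log 2/2) σ ∫_z^y t^{-σ} dt - log 4 · z^{1-σ} - c₁` for `σ > 0`,
`2 ≤ z ≤ y`. [folklore] -/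
theorem exists_sum_primesLE_log_mul_rpow_sub_ge :
    ∃ c₁ : ℝ, 0 ≤ c₁ ∧ ∀ (σ : ℝ) (z y : ℕ), 0 < σ → 2 ≤ z → z ≤ y →
      Real.log 2 / 2 * σ * (∫ t in (z : ℝ)..y, t ^ (-σ)) - Real.log 4 * (z : ℝ) ^ (1 - σ) - c₁ ≤
        ∑ p ∈ Nat.primesLE y, Real.log p * (p : ℝ) ^ (-σ) -
          ∑ p ∈ Nat.primesLE z, Real.log p * (p : ℝ) ^ (-σ) := by
  obtain ⟨c₁, hc₁, hθ⟩ := exists_theta_ge_linear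
  refine ⟨c₁, hc₁, fun σ z y hσ hz hzy => ?_⟩
  have hy : 2 ≤ y := le_trans hz hzy
  have hz2 : (2 : ℝ) ≤ (z : ℝ) := by exact_mod_cast hz
  have hz0 : (0 : ℝ) < (z : ℝ) := by linarith
  have hzy' : (z : ℝ) ≤ (y : ℝ) := by exact_mod_cast hzy
  have hy0 : (0 : ℝ) < (y : ℝ) := by linarith
  set c₀ : ℝ := Real.log 2 / 2 with hc₀
  have hc₀0 : 0 < c₀ := by rw [hc₀]; exact div_pos (Real.log_pos one_lt_two) two_pos
  rw [sum_primesLE_log_mul_rpow_eq σ hy, sum_primesLE_log_mul_rpow_eq σ hz]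
  -- split `∫₂^y = ∫₂^z + ∫_z^y`
  have hsplit : ∫ t in (2 : ℝ)..y, θ t * t ^ (-σ - 1) =
      (∫ t in (2 : ℝ)..z, θ t * t ^ (-σ - 1)) + ∫ t in (z : ℝ)..y, θ t * t ^ (-σ - 1) :=
    (intervalIntegral.integral_add_adjacent_intervals
      (intervalIntegrable_theta_mul_rpow _ two_pos hz0)
      (intervalIntegrable_theta_mul_rpow _ hz0 hy0)).symm
  rw [hsplit]
  -- boundary terms: `θ(y) y^{-σ} ≥ 0`, `θ(z) z^{-σ} ≤ log 4 · z^{1-σ}`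
  have h1 : 0 ≤ θ y * (y : ℝ) ^ (-σ) := mul_nonneg (theta_nonneg _) (Real.rpow_nonneg hy0.le _)
  have h2 : θ z * (z : ℝ) ^ (-σ) ≤ Real.log 4 * (z : ℝ) ^ (1 - σ) := by
    calc θ z * (z : ℝ) ^ (-σ) ≤ Real.log 4 * z * (z : ℝ) ^ (-σ) :=
          mul_le_mul_of_nonneg_right (theta_le_log4_mul_x hz0.le) (Real.rpow_nonneg hz0.le _)
      _ = Real.log 4 * (z : ℝ) ^ (1 - σ) := by
          have h := Real.rpow_add hz0 1 (-σ)
          rw [Real.rpow_one, show (1 : ℝ) + -σ = 1 - σ by ring] at h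
          rw [mul_assoc, h]
  -- the integral on `[z, y]`
  have hint_rpow : ∀ r : ℝ, IntervalIntegrable (fun t : ℝ => t ^ r) volume (z : ℝ) y := fun r =>
    intervalIntegral.intervalIntegrable_rpow (Or.inr fun h => by
      rcases Set.mem_uIcc.1 h with h | h <;> linarith [h.1])
  have h3 : ∫ t in (z : ℝ)..y, (c₀ * t ^ (-σ) - c₁ * t ^ (-σ - 1)) ≤
      ∫ t in (z : ℝ)..y, θ t * t ^ (-σ - 1) := by
    refine intervalIntegral.integral_mono_on hzy' (((hint_rpow _).const_mul _).sub
      ((hint_rpow _).const_mul _)) (intervalIntegrable_theta_mul_rpow _ hz0 hy0) fun t ht => ?_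
    have ht0 : 0 < t := by linarith [ht.1]
    have hpow : t ^ (-σ) = t * t ^ (-σ - 1) := by
      have h := Real.rpow_add ht0 1 (-σ - 1)
      rw [Real.rpow_one, show (1 : ℝ) + (-σ - 1) = -σ by ring] at h
      exact h
    calc c₀ * t ^ (-σ) - c₁ * t ^ (-σ - 1) = (c₀ * t - c₁) * t ^ (-σ - 1) := by rw [hpow]; ring
      _ ≤ θ t * t ^ (-σ - 1) :=
          mul_le_mul_of_nonneg_right (hθ t ht0.le) (Real.rpow_nonneg ht0.le _)
  rw [intervalIntegral.integral_sub ((hint_rpow _).const_mul _) ((hint_rpow _).const_mul _),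
    intervalIntegral.integral_const_mul, intervalIntegral.integral_const_mul] at h3
  have h4 : σ * ∫ t in (z : ℝ)..y, t ^ (-σ - 1) ≤ 1 := by
    rw [integral_rpow (Or.inr ⟨by linarith, fun h => by
      rcases Set.mem_uIcc.1 h with h | h <;> linarith [h.1]⟩)]
    rw [show (-σ - 1 + 1) = -σ by ring]
    have hzσ : (z : ℝ) ^ (-σ) ≤ 1 :=
      Real.rpow_le_one_of_one_le_of_nonpos (by linarith) (by linarith)
    have hyσ : 0 ≤ (y : ℝ) ^ (-σ) := Real.rpow_nonneg hy0.le _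
    have : σ * (((y : ℝ) ^ (-σ) - (z : ℝ) ^ (-σ)) / -σ) = (z : ℝ) ^ (-σ) - (y : ℝ) ^ (-σ) := by
      field_simp
      ring
    rw [this]
    linarith
  have h5 : σ * ∫ t in (z : ℝ)..y, θ t * t ^ (-σ - 1) ≥
      σ * (c₀ * ∫ t in (z : ℝ)..y, t ^ (-σ)) - c₁ * (σ * ∫ t in (z : ℝ)..y, t ^ (-σ - 1)) := by
    have := mul_le_mul_of_nonneg_left h3 hσ.le
    linarith
  have h6 : c₁ * (σ * ∫ t in (z : ℝ)..y, t ^ (-σ - 1)) ≤ c₁ := by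
    have := mul_le_mul_of_nonneg_left h4 hc₁
    linarith
  have h7 : 0 ≤ σ * ∫ t in (2 : ℝ)..z, θ t * t ^ (-σ - 1) := by
    refine mul_nonneg hσ.le (intervalIntegral.integral_nonneg hz2 fun t ht => ?_)
    exact mul_nonneg (theta_nonneg _) (Real.rpow_nonneg (by linarith [ht.1]) _)
  nlinarith

/-- `∫_z^y t^{-σ} dt ≥ e^{-4} log(y/z)` for `0 < σ ≤ 1 + 4/log y`, `1 ≤ z ≤ y`, `y > 1` (on `[z, y]`,
`t^{-σ} = t^{-1} t^{1-σ} ≥ e^{-4} t^{-1}`). [folklore] -/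
theorem exp_neg_four_mul_log_le_integral_rpow_neg {z w : ℝ} (hz : 1 ≤ z) (hzw : z ≤ w) (hw : 1 < w)
    (hσ : σ ≤ 1 + 4 / Real.log w) :
    Real.exp (-4) * Real.log (w / z) ≤ ∫ t in z..w, t ^ (-σ) := by
  have hz0 : 0 < z := by linarith
  have hw0 : 0 < w := by linarith
  have hlogw : 0 < Real.log w := Real.log_pos hw
  have hint_rpow : ∀ r : ℝ, IntervalIntegrable (fun t : ℝ => t ^ r) volume z w := fun r =>
    intervalIntegral.intervalIntegrable_rpow (Or.inr fun h => by
      rcases Set.mem_uIcc.1 h with h | h <;> linarith [h.1])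
  have hmono : ∫ t in z..w, Real.exp (-4) * t ^ (-1 : ℝ) ≤ ∫ t in z..w, t ^ (-σ) := by
    refine intervalIntegral.integral_mono_on hzw ((hint_rpow _).const_mul _) (hint_rpow _)
      fun t ht => ?_
    have ht1 : 1 ≤ t := le_trans hz ht.1
    have ht0 : 0 < t := by linarith
    have htw : t ≤ w := ht.2
    -- `t^{-σ} = t^{-1} · t^{1-σ}` and `t^{1-σ} ≥ e^{-4}`
    have hsplit : t ^ (-σ) = t ^ (-1 : ℝ) * t ^ (1 - σ) := by
      rw [← Real.rpow_add ht0]; ring_nf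
    have hlow : Real.exp (-4) ≤ t ^ (1 - σ) := by
      by_cases h1 : σ ≤ 1
      · calc Real.exp (-4) ≤ 1 := Real.exp_le_one_iff.2 (by norm_num)
          _ ≤ t ^ (1 - σ) := Real.one_le_rpow ht1 (by linarith)
      · push Not at h1
        -- `t^{1-σ} ≥ w^{1-σ} ≥ w^{-4/log w} = e^{-4}`
        have hexp : -(4 / Real.log w) ≤ 1 - σ := by linarith
        calc Real.exp (-4) = w ^ (-(4 / Real.log w)) := by
              rw [Real.rpow_def_of_pos hw0]; congr 1; field_simp
          _ ≤ w ^ (1 - σ) := Real.rpow_le_rpow_of_exponent_le hw.le hexp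
          _ ≤ t ^ (1 - σ) := Real.rpow_le_rpow_of_nonpos ht0 htw (by linarith)
    rw [hsplit]
    calc Real.exp (-4) * t ^ (-1 : ℝ) = t ^ (-1 : ℝ) * Real.exp (-4) := mul_comm _ _
      _ ≤ t ^ (-1 : ℝ) * t ^ (1 - σ) := mul_le_mul_of_nonneg_left hlow (Real.rpow_nonneg ht0.le _)
  rw [intervalIntegral.integral_const_mul] at hmono
  have hinv : ∫ t in z..w, t ^ (-1 : ℝ) = Real.log (w / z) := by
    rw [← integral_inv (fun h => by rcases Set.mem_uIcc.1 h with h | h <;> linarith [h.1])]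
    refine intervalIntegral.integral_congr fun t ht => ?_
    have ht0 : 0 < t := by
      rcases Set.mem_uIcc.1 ht with h | h <;> linarith [h.1]
    simp [Real.rpow_neg_one]
  rw [hinv] at hmono
  exact hmono


/-! ### `φ₂(α, y) ≍ log x · log y` in the range `(log x)^3 ≤ y ≤ x` -/

variable {x : ℝ}

/-- **`α(x, y) ≥ 3/5`** in the range `(log x)^3 ≤ y ≤ x`, `x ≥ x₀` (from `y^{1-α} ≪ u log(u+1) ≤ y^{2/5}`).
[cite: HildebrandTenenbaum1986, Lemma 2 (3.4)–(3.5)] -/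
theorem three_fifths_le_saddlePoint :
    ∃ x₀ : ℝ, ∀ (x : ℝ) (y : ℕ), x₀ ≤ x → Real.log x ^ 3 ≤ y → (y : ℝ) ≤ x →
      3 / 5 ≤ saddlePoint x y := by
  obtain ⟨C, x₁, hC, hA⟩ := rpow_one_sub_saddlePoint_le
  obtain ⟨Y, hY1, hY⟩ :=
    exists_log_le_mul_rpow (κ := 1 / C) (ε := 1 / 15) (by positivity) (by norm_num)
  refine ⟨max x₁ (Real.exp (max Y 8)), fun x y hx hlx hyx => ?_⟩
  have hx₁ : x₁ ≤ x := le_trans (le_max_left _ _) hx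
  have hlogx : max Y 8 ≤ Real.log x := by
    have := Real.log_le_log (Real.exp_pos _) (le_trans (le_max_right _ _) hx)
    rwa [Real.log_exp] at this
  have hlogx8 : 8 ≤ Real.log x := le_trans (le_max_right _ _) hlogx
  have hlogx_le_y : Real.log x ≤ y := by
    have : Real.log x ≤ Real.log x ^ 3 := by
      calc Real.log x = Real.log x * 1 * 1 := by ring
        _ ≤ Real.log x * Real.log x * Real.log x := by gcongr <;> linarith
        _ = Real.log x ^ 3 := by ring
    linarith
  have hy8 : 8 ≤ y := by exact_mod_cast (show (8 : ℝ) ≤ y by linarith)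
  have hyY : Y ≤ y := by linarith [le_max_left Y 8]
  obtain ⟨hx1, hy2, hlogy1, -, hu1, -, huy, hlogu⟩ := range_aux hy8 hlx hyx
  have hy0 : (0 : ℝ) < y := by exact_mod_cast (lt_of_lt_of_le (by norm_num) hy8)
  have hy1 : (1 : ℝ) < y := by exact_mod_cast (lt_of_lt_of_le (by norm_num) hy8)
  set u : ℝ := Real.log x / Real.log y with hu
  have hu0 : 0 < u := by linarith
  have hlogu0 : 0 < Real.log (u + 1) := Real.log_pos (by linarith)
  have h := hA x y hx₁ hlx hyx
  -- `C u log(u+1) ≤ C y^{1/3} log y ≤ y^{2/5}`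
  have hbound : C * (u * Real.log (u + 1)) ≤ (y : ℝ) ^ (2 / 5 : ℝ) := by
    have h1 := hY y hyY
    calc C * (u * Real.log (u + 1)) ≤ C * ((y : ℝ) ^ (1 / 3 : ℝ) * Real.log y) :=
          mul_le_mul_of_nonneg_left
            (mul_le_mul huy hlogu hlogu0.le (Real.rpow_nonneg hy0.le _)) hC.le
      _ ≤ C * ((y : ℝ) ^ (1 / 3 : ℝ) * (1 / C * (y : ℝ) ^ (1 / 15 : ℝ))) :=
          mul_le_mul_of_nonneg_left
            (mul_le_mul_of_nonneg_left h1 (Real.rpow_nonneg hy0.le _)) hC.le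
      _ = (y : ℝ) ^ (1 / 3 : ℝ) * (y : ℝ) ^ (1 / 15 : ℝ) := by field_simp
      _ = (y : ℝ) ^ (2 / 5 : ℝ) := by rw [← Real.rpow_add hy0]; norm_num
  have h2 : (y : ℝ) ^ (1 - saddlePoint x y) ≤ (y : ℝ) ^ (2 / 5 : ℝ) := le_trans h hbound
  have h3 : 1 - saddlePoint x y ≤ 2 / 5 := (Real.rpow_le_rpow_left_iff hy1).1 h2
  linarith

/-- **`φ₂(α(x, y), y) ≤ 3 log x · log y`** in the range `(log x)^3 ≤ y ≤ x`, `x ≥ x₀` — the upper half of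
Hildebrand–Tenenbaum's `φ₂(α, y) = (1 + (log x)/y) log x · log y · (1 + O(1/log(1+u) + 1/log y))`
[HildebrandTenenbaum1986, Thm 2 (2.5); Lemma 4 (3.8) for k = 2], up to the constant, from
`φ₂ ≤ 3 log y · (-φ₁)` and the saddle-point equation `-φ₁(α, y) = log x`.
[cite: HildebrandTenenbaum1986, Thm 2 (2.5) and Lemma 4 (3.8)] -/
theorem saddlePhi₂_saddlePoint_le :
    ∃ x₀ : ℝ, ∀ (x : ℝ) (y : ℕ), x₀ ≤ x → Real.log x ^ 3 ≤ y → (y : ℝ) ≤ x →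
      saddlePhi₂ (saddlePoint x y) y ≤ 3 * Real.log x * Real.log y := by
  obtain ⟨x₃, h35⟩ := three_fifths_le_saddlePoint
  refine ⟨max x₃ (Real.exp 8), fun x y hx hlx hyx => ?_⟩
  have hx₃ : x₃ ≤ x := le_trans (le_max_left _ _) hx
  have hlogx8 : 8 ≤ Real.log x := by
    have := Real.log_le_log (Real.exp_pos _) (le_trans (le_max_right _ _) hx)
    rwa [Real.log_exp] at this
  have hlogx_le_y : Real.log x ≤ y := by
    have : Real.log x ≤ Real.log x ^ 3 := by
      calc Real.log x = Real.log x * 1 * 1 := by ring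
        _ ≤ Real.log x * Real.log x * Real.log x := by gcongr <;> linarith
        _ = Real.log x ^ 3 := by ring
    linarith
  have hy8 : 8 ≤ y := by exact_mod_cast (show (8 : ℝ) ≤ y by linarith)
  obtain ⟨hx1, hy2, -, -, -, -, -, -⟩ := range_aux hy8 hlx hyx
  have hα := h35 x y hx₃ hlx hyx
  calc saddlePhi₂ (saddlePoint x y) y ≤ 3 * Real.log y * saddleSum (saddlePoint x y) y :=
        saddlePhi₂_le_mul_saddleSum hα y
    _ = 3 * Real.log x * Real.log y := by rw [saddleSum_saddlePoint hx1 hy2]; ring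

set_option maxHeartbeats 1600000 in
/-- **`φ₂(α(x, y), y) ≥ c log x · log y`** (`c > 0` absolute) in the range `(log x)^3 ≤ y ≤ x`, `x ≥ x₀` —
the lower half of [HildebrandTenenbaum1986, Thm 2 (2.5); Lemma 4 (3.8), k = 2] up to the constant.
Proof: `φ₂(α, y) ≥ Σ_{√y < p ≤ y} log² p · p^{-α} ≥ ½ log y · Σ_{√y < p ≤ y} log p · p^{-α}`, and by
partial summation on `[√y, y]` the last sum is `≥ (log 2/2) α ∫_{√y}^y t^{-α} dt - log 4 · y^{(1-α)/2}
- c₁ ≫ log x`, using `∫_{√y}^y t^{-α} dt ≥ (3/4) y^{1-α} log y/log(y^{1-α})` when `y^{1-α} ≥ 16` together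
with `y^{1-α} ≍ u log(u+1)` (`SmoothSaddlePointApprox`), and `∫_{√y}^y t^{-α} dt ≥ e^{-4} log √y` when
`y^{1-α} < 16` (then `u` is bounded and `α ≤ 1 + 4/log y`).
[cite: HildebrandTenenbaum1986, Thm 2 (2.5) and Lemma 4 (3.8)] -/
theorem le_saddlePhi₂_saddlePoint :
    ∃ c x₀ : ℝ, 0 < c ∧ ∀ (x : ℝ) (y : ℕ), x₀ ≤ x → Real.log x ^ 3 ≤ y → (y : ℝ) ≤ x →
      c * (Real.log x * Real.log y) ≤ saddlePhi₂ (saddlePoint x y) y := by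
  obtain ⟨C, x₁, hC, hA⟩ := rpow_one_sub_saddlePoint_le
  obtain ⟨c, x₂, hc, hB⟩ := le_rpow_one_sub_saddlePoint
  obtain ⟨c₁, hc₁, hS⟩ := exists_sum_primesLE_log_mul_rpow_sub_ge
  obtain ⟨x₃, h35⟩ := three_fifths_le_saddlePoint
  set ℓ : ℝ := Real.log 2 with hℓ
  have hℓ0 : 0 < ℓ := Real.log_pos one_lt_two
  set c₀ : ℝ := ℓ / 2 with hc₀
  have hc₀0 : 0 < c₀ := by positivity
  have hl4 := log_four_le
  have hl40 : 0 < Real.log 4 := Real.log_pos (by norm_num)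
  -- constants
  set u₀ : ℝ := 16 / (c * ℓ) with hu₀
  have hu₀0 : 0 < u₀ := by positivity
  set K : ℝ := |Real.log C| / ℓ + 2 with hK
  have hK0 : 0 < K := by positivity
  set L₁ : ℝ := 10 * Real.exp 4 * (6 + c₁) / c₀ with hL₁
  set L₂ : ℝ := 40 * K * (Real.log 4 * C ^ (1 / 2 : ℝ) + c₁) / (9 * c₀ * c) with hL₂
  set cD : ℝ := min (c₀ * Real.exp (-4) / (5 * u₀)) (9 * c₀ * c / (40 * K)) with hcD
  have hcD0 : 0 < cD := lt_min (by positivity) (by positivity)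
  set T₀ : ℝ := max (max ((⌈Real.exp 107⌉₊ : ℕ) : ℝ) 16) (max (Real.exp L₁) (Real.exp L₂)) with hT₀
  refine ⟨cD / 2, max (max (max x₁ x₂) x₃) (Real.exp T₀), by positivity,
    fun x y hx hlx hyx => ?_⟩
  -- thresholds
  have hx₁ : x₁ ≤ x :=
    le_trans (le_trans (le_trans (le_max_left _ _) (le_max_left _ _)) (le_max_left _ _)) hx
  have hx₂ : x₂ ≤ x :=
    le_trans (le_trans (le_trans (le_max_right _ _) (le_max_left _ _)) (le_max_left _ _)) hx
  have hx₃ : x₃ ≤ x := le_trans (le_trans (le_max_right _ _) (le_max_left _ _)) hx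
  have hlogx : T₀ ≤ Real.log x := by
    have := Real.log_le_log (Real.exp_pos _) (le_trans (le_max_right _ _) hx)
    rwa [Real.log_exp] at this
  have hT16 : (16 : ℝ) ≤ T₀ := le_trans (le_max_right _ _) (le_max_left _ _)
  have hT107 : ((⌈Real.exp 107⌉₊ : ℕ) : ℝ) ≤ T₀ := le_trans (le_max_left _ _) (le_max_left _ _)
  have hTL₁ : Real.exp L₁ ≤ T₀ := le_trans (le_max_left _ _) (le_max_right _ _)
  have hTL₂ : Real.exp L₂ ≤ T₀ := le_trans (le_max_right _ _) (le_max_right _ _)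
  have hlogx16 : 16 ≤ Real.log x := le_trans hT16 hlogx
  have hlogx_le_y : Real.log x ≤ y := by
    have : Real.log x ≤ Real.log x ^ 3 := by
      calc Real.log x = Real.log x * 1 * 1 := by ring
        _ ≤ Real.log x * Real.log x * Real.log x := by gcongr <;> linarith
        _ = Real.log x ^ 3 := by ring
    linarith
  have hy16r : (16 : ℝ) ≤ y := by linarith
  have hy8 : 8 ≤ y := by exact_mod_cast (show (8 : ℝ) ≤ y by linarith)
  have hy16 : 16 ≤ y := by exact_mod_cast hy16r
  have hy107 : ⌈Real.exp 107⌉₊ ≤ y := by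
    exact_mod_cast (show ((⌈Real.exp 107⌉₊ : ℕ) : ℝ) ≤ y by linarith)
  have hlogy_L₁ : L₁ ≤ Real.log y := by
    have h : Real.exp L₁ ≤ y := by linarith
    have := Real.log_le_log (Real.exp_pos _) h
    rwa [Real.log_exp] at this
  have hlogy_L₂ : L₂ ≤ Real.log y := by
    have h : Real.exp L₂ ≤ y := by linarith
    have := Real.log_le_log (Real.exp_pos _) h
    rwa [Real.log_exp] at this
  obtain ⟨hx1, hy2, hlogy1, hlogyx, hu1, -, huy, hlogu⟩ := range_aux hy8 hlx hyx
  have hy0 : (0 : ℝ) < y := by linarith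
  have hy1 : (1 : ℝ) < y := by linarith
  have hlogy0 : 0 < Real.log y := by linarith
  set u : ℝ := Real.log x / Real.log y with hu
  have hulogy : u * Real.log y = Real.log x := by rw [hu]; field_simp
  have hu0 : 0 < u := by linarith
  have hlogu2 : ℓ ≤ Real.log (u + 1) := Real.log_le_log two_pos (by linarith)
  have hlogu0 : 0 < Real.log (u + 1) := lt_of_lt_of_le hℓ0 hlogu2
  have hlogu_le_u : Real.log (u + 1) ≤ u := by
    have := Real.log_le_sub_one_of_pos (show 0 < u + 1 by linarith); linarith
  set E₀ : ℝ := u * Real.log (u + 1) with hE₀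
  have hE₀0 : 0 < E₀ := by positivity
  have hE₀u : E₀ ≤ u ^ 2 := by rw [hE₀, sq]; exact mul_le_mul_of_nonneg_left hlogu_le_u hu0.le
  set α : ℝ := saddlePoint x y with hαdef
  have hα35 : 3 / 5 ≤ α := h35 x y hx₃ hlx hyx
  have hα0 : 0 < α := by linarith
  set E : ℝ := (y : ℝ) ^ (1 - α) with hE
  have hE0 : 0 < E := Real.rpow_pos_of_pos hy0 _
  have hEA : E ≤ C * E₀ := hA x y hx₁ hlx hyx
  have hEB : c * E₀ ≤ E := hB x y hx₂ hlx hyx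
  have hcC : c ≤ C := by
    have := le_trans hEB hEA
    exact le_of_mul_le_mul_right this hE₀0
  -- `z = ⌊√y⌋`
  set z : ℕ := Nat.sqrt y with hz
  have hz4 : 4 ≤ z := by rw [hz, Nat.le_sqrt]; omega
  have hz2 : 2 ≤ z := le_trans (by norm_num) hz4
  have hzz : z * z ≤ y := Nat.sqrt_le y
  have hzy : z ≤ y := le_trans (Nat.le_mul_self z) hzz
  have hylt : y < (z + 1) * (z + 1) := Nat.lt_succ_sqrt y
  have hz1r : (1 : ℝ) ≤ z := by exact_mod_cast (le_trans (by norm_num) hz2)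
  have hz0r : (0 : ℝ) < z := by linarith
  have hzsq : ((z : ℝ)) ^ 2 ≤ y := by exact_mod_cast (show z ^ 2 ≤ y by rw [sq]; exact hzz)
  have hylt' : (y : ℝ) < ((z : ℝ) + 1) ^ 2 := by
    exact_mod_cast (show y < (z + 1) ^ 2 by rw [sq]; exact hylt)
  -- `log p ≥ log(z+1) ≥ (log y)/2` for `p > z`
  have hlogz1 : Real.log y / 2 ≤ Real.log ((z : ℝ) + 1) := by
    have h := Real.log_le_log hy0 hylt'.le
    rw [Real.log_pow] at h
    push_cast at h
    linarith
  -- Step 1: `φ₂(α, y) ≥ (log y/2) · Σ_{z < p ≤ y} log p · p^{-α}`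
  have hsub : Nat.primesLE z ⊆ Nat.primesLE y := fun p hp => by
    obtain ⟨hpz, hpp⟩ := Nat.mem_primesLE.1 hp
    exact Nat.mem_primesLE.2 ⟨le_trans hpz hzy, hpp⟩
  set D : ℝ := ∑ p ∈ Nat.primesLE y, Real.log p * (p : ℝ) ^ (-α) -
      ∑ p ∈ Nat.primesLE z, Real.log p * (p : ℝ) ^ (-α) with hD
  have hD_eq : D = ∑ p ∈ Nat.primesLE y \ Nat.primesLE z, Real.log p * (p : ℝ) ^ (-α) := by
    rw [hD, ← Finset.sum_sdiff hsub]; ring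
  have hstep1 : Real.log y / 2 * D ≤ saddlePhi₂ α y := by
    calc Real.log y / 2 * D
        = ∑ p ∈ Nat.primesLE y \ Nat.primesLE z,
            Real.log y / 2 * (Real.log p * (p : ℝ) ^ (-α)) := by
          rw [hD_eq, Finset.mul_sum]
      _ ≤ ∑ p ∈ Nat.primesLE y \ Nat.primesLE z, Real.log p ^ 2 * (p : ℝ) ^ (-α) := by
          refine Finset.sum_le_sum fun p hp => ?_
          obtain ⟨hpy, hpz⟩ := Finset.mem_sdiff.1 hp
          obtain ⟨hpy', hpp⟩ := Nat.mem_primesLE.1 hpy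
          have hpgt : z < p := by
            by_contra hle
            push Not at hle
            exact hpz (Nat.mem_primesLE.2 ⟨hle, hpp⟩)
          have hp0 : (0 : ℝ) < p := by exact_mod_cast hpp.pos
          have hlogp : Real.log y / 2 ≤ Real.log p := by
            refine le_trans hlogz1 (Real.log_le_log (by linarith) ?_)
            exact_mod_cast hpgt
          have hlogp0 : 0 ≤ Real.log p := Real.log_nonneg (by exact_mod_cast hpp.one_lt.le)
          calc Real.log y / 2 * (Real.log p * (p : ℝ) ^ (-α))
              = Real.log y / 2 * Real.log p * (p : ℝ) ^ (-α) := by ring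
            _ ≤ Real.log p * Real.log p * (p : ℝ) ^ (-α) := by
                refine mul_le_mul_of_nonneg_right ?_ (Real.rpow_nonneg hp0.le _)
                exact mul_le_mul_of_nonneg_right hlogp hlogp0
            _ = Real.log p ^ 2 * (p : ℝ) ^ (-α) := by ring
      _ ≤ ∑ p ∈ Nat.primesLE y, Real.log p ^ 2 * (p : ℝ) ^ (-α) := by
          refine Finset.sum_le_sum_of_subset_of_nonneg Finset.sdiff_subset fun p hp _ => ?_
          have hp0 : (0 : ℝ) ≤ p := Nat.cast_nonneg _
          exact mul_nonneg (sq_nonneg _) (Real.rpow_nonneg hp0 _)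
      _ ≤ saddlePhi₂ α y := sum_log_sq_mul_rpow_le_saddlePhi₂ hα0 y
  -- Step 2: partial summation on `[z, y]`
  have hD_ge : Real.log 2 / 2 * α * (∫ t in (z : ℝ)..y, t ^ (-α)) -
      Real.log 4 * (z : ℝ) ^ (1 - α) - c₁ ≤ D := hS α z y hα0 hz2 hzy
  have hI0 : 0 ≤ ∫ t in (z : ℝ)..y, t ^ (-α) :=
    intervalIntegral.integral_nonneg (by exact_mod_cast hzy) fun t ht =>
      Real.rpow_nonneg (by linarith [ht.1]) _
  -- Step 3: `D ≥ cD · log x` in the two regimes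
  have hDmain : cD * Real.log x ≤ D := by
    by_cases hE16 : E < 16
    · -- bounded `u`: `∫_z^y t^{-α} ≥ e^{-4} log(y/z) ≥ e^{-4} (log y)/2`, `z^{1-α} ≤ 4`
      have hαle : α ≤ 1 + 4 / Real.log y := saddlePoint_le_one_add_div_log x y hy107 hyx
      have hI : Real.exp (-4) * (Real.log y / 2) ≤ ∫ t in (z : ℝ)..y, t ^ (-α) := by
        have h := exp_neg_four_mul_log_le_integral_rpow_neg (σ := α) hz1r (by exact_mod_cast hzy)
          hy1 hαle
        have hlogyz : Real.log y / 2 ≤ Real.log ((y : ℝ) / z) := by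
          rw [Real.log_div hy0.ne' hz0r.ne']
          have : Real.log z ≤ Real.log y / 2 := by
            have h2 := Real.log_le_log (by positivity) hzsq
            rw [Real.log_pow] at h2; push_cast at h2; linarith
          linarith
        exact le_trans (mul_le_mul_of_nonneg_left hlogyz (Real.exp_pos _).le) h
      have hzpow : (z : ℝ) ^ (1 - α) ≤ 4 := by
        by_cases hα1 : α ≤ 1
        · -- `z^{1-α} ≤ y^{(1-α)/2} = E^{1/2} ≤ 4`
          have h1 : (z : ℝ) ^ (1 - α) ≤ (y : ℝ) ^ ((1 - α) / 2) := by
            calc (z : ℝ) ^ (1 - α) = (((z : ℝ)) ^ 2) ^ ((1 - α) / 2) := by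
                  rw [← Real.rpow_natCast, ← Real.rpow_mul hz0r.le]; congr 1; push_cast; ring
              _ ≤ (y : ℝ) ^ ((1 - α) / 2) := Real.rpow_le_rpow (by positivity) hzsq (by linarith)
          have h2 : (y : ℝ) ^ ((1 - α) / 2) = E ^ (1 / 2 : ℝ) := by
            rw [hE, ← Real.rpow_mul hy0.le]; ring_nf
          have h3 : E ^ (1 / 2 : ℝ) ≤ (16 : ℝ) ^ (1 / 2 : ℝ) :=
            Real.rpow_le_rpow hE0.le hE16.le (by norm_num)
          have h4 : (16 : ℝ) ^ (1 / 2 : ℝ) = 4 := by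
            rw [show (16 : ℝ) = 4 ^ 2 by norm_num, ← Real.rpow_natCast,
              ← Real.rpow_mul (by norm_num : (0 : ℝ) ≤ 4)]
            norm_num
          linarith [h1.trans_eq h2]
        · push Not at hα1
          calc (z : ℝ) ^ (1 - α) ≤ 1 := Real.rpow_le_one_of_one_le_of_nonpos hz1r (by linarith)
            _ ≤ 4 := by norm_num
      -- `u < u₀`
      have hu_lt : u < u₀ := by
        have h1 : c * E₀ < 16 := lt_of_le_of_lt hEB hE16
        have h2 : c * (u * ℓ) ≤ c * E₀ :=
          mul_le_mul_of_nonneg_left (mul_le_mul_of_nonneg_left hlogu2 hu0.le) hc.le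
        rw [hu₀, lt_div_iff₀ (by positivity)]
        have h3 : u * (c * ℓ) = c * (u * ℓ) := by ring
        linarith
      -- `D ≥ (3c₀/10) e^{-4} log y - 6 - c₁ ≥ (c₀ e^{-4}/5) log y ≥ (c₀ e^{-4}/(5u₀)) log x`
      have h1 : Real.log 2 / 2 * α * (∫ t in (z : ℝ)..y, t ^ (-α)) ≥
          c₀ * (3 / 5) * (Real.exp (-4) * (Real.log y / 2)) := by
        rw [← hℓ, ← hc₀]
        calc c₀ * (3 / 5) * (Real.exp (-4) * (Real.log y / 2))
            ≤ c₀ * α * (Real.exp (-4) * (Real.log y / 2)) := by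
              refine mul_le_mul_of_nonneg_right (mul_le_mul_of_nonneg_left hα35 hc₀0.le) ?_
              positivity
          _ ≤ c₀ * α * ∫ t in (z : ℝ)..y, t ^ (-α) := mul_le_mul_of_nonneg_left hI (by positivity)
      have h2 : Real.log 4 * (z : ℝ) ^ (1 - α) ≤ 6 :=
        le_trans (mul_le_mul_of_nonneg_left hzpow hl40.le) (by linarith)
      have hL₁' : 10 * Real.exp 4 * (6 + c₁) ≤ c₀ * Real.log y := by
        have := (div_le_iff₀ hc₀0).1 (hL₁.symm.le.trans hlogy_L₁)
        linarith
      have hee : Real.exp 4 * Real.exp (-4) = 1 := by rw [← Real.exp_add]; norm_num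
      have h3 : c₀ * Real.exp (-4) / 5 * Real.log y ≤ D := by
        -- `D ≥ (3/10) c₀ e^{-4} log y - 6 - c₁` and `(1/10) c₀ e^{-4} log y ≥ 6 + c₁`
        have h4 : 6 + c₁ ≤ c₀ * Real.exp (-4) / 10 * Real.log y := by
          have hm := mul_le_mul_of_nonneg_left hL₁' (Real.exp_pos (-4)).le
          have heq : Real.exp (-4) * (10 * Real.exp 4 * (6 + c₁)) = 10 * (6 + c₁) := by
            rw [show Real.exp (-4) * (10 * Real.exp 4 * (6 + c₁)) =
              10 * (6 + c₁) * (Real.exp 4 * Real.exp (-4)) by ring, hee, mul_one]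
          rw [heq] at hm
          linarith
        linarith [hD_ge, h1, h2, h4]
      have h5 : cD * Real.log x ≤ c₀ * Real.exp (-4) / (5 * u₀) * Real.log x :=
        mul_le_mul_of_nonneg_right (min_le_left _ _) (by linarith)
      have h6 : c₀ * Real.exp (-4) / (5 * u₀) * Real.log x ≤
          c₀ * Real.exp (-4) / 5 * Real.log y := by
        rw [← hulogy]
        have : u * Real.log y ≤ u₀ * Real.log y := mul_le_mul_of_nonneg_right hu_lt.le hlogy0.le
        calc c₀ * Real.exp (-4) / (5 * u₀) * (u * Real.log y)
            ≤ c₀ * Real.exp (-4) / (5 * u₀) * (u₀ * Real.log y) :=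
              mul_le_mul_of_nonneg_left this (by positivity)
          _ = c₀ * Real.exp (-4) / 5 * Real.log y := by field_simp
      linarith
    · -- large `u`: `E ≥ 16`, `α < 1`, `∫_z^y t^{-α} ≥ (3E/4) log y/log E`
      push Not at hE16
      have hα1 : α < 1 := by
        by_contra h
        push Not at h
        have : E ≤ 1 := Real.rpow_le_one_of_one_le_of_nonpos hy1.le (by linarith)
        linarith
      have h1α : 0 < 1 - α := by linarith
      have hlogE : Real.log E = (1 - α) * Real.log y := by rw [hE, Real.log_rpow hy0]
      have hlogE0 : 0 < Real.log E := by rw [hlogE]; positivity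
      have hlogE16 : Real.log 16 ≤ Real.log E := Real.log_le_log (by norm_num) hE16
      -- `z^{1-α} ≤ E^{1/2} ≤ E/4`
      have hEhalf : (z : ℝ) ^ (1 - α) ≤ E ^ (1 / 2 : ℝ) := by
        calc (z : ℝ) ^ (1 - α) = (((z : ℝ)) ^ 2) ^ ((1 - α) / 2) := by
              rw [← Real.rpow_natCast, ← Real.rpow_mul hz0r.le]; congr 1; push_cast; ring
          _ ≤ (y : ℝ) ^ ((1 - α) / 2) := Real.rpow_le_rpow (by positivity) hzsq (by linarith)
          _ = E ^ (1 / 2 : ℝ) := by rw [hE, ← Real.rpow_mul hy0.le]; ring_nf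
      have hsqrtE : E ^ (1 / 2 : ℝ) ≤ E / 4 := by
        -- `E^{1/2} · E^{1/2} = E` and `E^{1/2} ≥ 4`
        have hs0 : 0 ≤ E ^ (1 / 2 : ℝ) := Real.rpow_nonneg hE0.le _
        have hss : E ^ (1 / 2 : ℝ) * E ^ (1 / 2 : ℝ) = E := by
          rw [← Real.rpow_add hE0]; norm_num
        have hs4 : 4 ≤ E ^ (1 / 2 : ℝ) := by
          have h4 : (16 : ℝ) ^ (1 / 2 : ℝ) = 4 := by
            rw [show (16 : ℝ) = 4 ^ 2 by norm_num, ← Real.rpow_natCast,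
              ← Real.rpow_mul (by norm_num : (0 : ℝ) ≤ 4)]
            norm_num
          rw [← h4]
          exact Real.rpow_le_rpow (by norm_num) hE16 (by norm_num)
        rw [le_div_iff₀ (by norm_num : (0 : ℝ) < 4)]
        calc E ^ (1 / 2 : ℝ) * 4 ≤ E ^ (1 / 2 : ℝ) * E ^ (1 / 2 : ℝ) :=
              mul_le_mul_of_nonneg_left hs4 hs0
          _ = E := hss
      have hI : 3 / 4 * E * (Real.log y / Real.log E) ≤ ∫ t in (z : ℝ)..y, t ^ (-α) := by
        rw [integral_rpow (Or.inr ⟨by linarith, fun h => by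
          rcases Set.mem_uIcc.1 h with h | h <;> linarith [h.1]⟩)]
        rw [show (-α + 1) = 1 - α by ring, ← hE]
        have heq : Real.log y / Real.log E = 1 / (1 - α) := by
          rw [hlogE]; field_simp
        rw [heq]
        rw [show 3 / 4 * E * (1 / (1 - α)) = (3 / 4 * E) / (1 - α) by ring]
        exact div_le_div_of_nonneg_right (by linarith) h1α.le
      -- `E/log E ≥ c E₀/log(C E₀) ≥ (c/K) u`
      have hCE₀ : E ≤ C * E₀ := hEA
      have hlogCE₀ : Real.log E ≤ Real.log (C * E₀) := Real.log_le_log hE0 hCE₀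
      have hlogCE₀K : Real.log (C * E₀) ≤ K * Real.log (u + 1) := by
        rw [Real.log_mul hC.ne' hE₀0.ne', hE₀, Real.log_mul hu0.ne' hlogu0.ne']
        have h1 : Real.log u ≤ Real.log (u + 1) := Real.log_le_log hu0 (by linarith)
        have h2 : Real.log (Real.log (u + 1)) ≤ Real.log (u + 1) := by
          have := Real.log_le_sub_one_of_pos hlogu0; linarith
        have h3 : Real.log C ≤ |Real.log C| / ℓ * Real.log (u + 1) := by
          calc Real.log C ≤ |Real.log C| := le_abs_self _
            _ = |Real.log C| / ℓ * ℓ := by field_simp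
            _ ≤ |Real.log C| / ℓ * Real.log (u + 1) :=
                mul_le_mul_of_nonneg_left hlogu2 (by positivity)
        rw [hK]
        linarith
      have hfrac : c / K * u ≤ E / Real.log E := by
        -- `E/log E ≥ c E₀/log E ≥ c E₀/(K log(u+1)) = (c/K) u`
        have hKl0 : 0 < K * Real.log (u + 1) := by positivity
        calc c / K * u = c * E₀ / (K * Real.log (u + 1)) := by rw [hE₀]; field_simp
          _ ≤ c * E₀ / Real.log E :=
              div_le_div_of_nonneg_left (by positivity) hlogE0 (le_trans hlogCE₀ hlogCE₀K)
          _ ≤ E / Real.log E := div_le_div_of_nonneg_right hEB hlogE0.le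
      -- junk: `log 4 · E^{1/2} + c₁ ≤ (log 4 · C^{1/2} + c₁) u`
      have hsqrt_le : E ^ (1 / 2 : ℝ) ≤ C ^ (1 / 2 : ℝ) * u := by
        calc E ^ (1 / 2 : ℝ) ≤ (C * E₀) ^ (1 / 2 : ℝ) := Real.rpow_le_rpow hE0.le hCE₀ (by norm_num)
          _ = C ^ (1 / 2 : ℝ) * E₀ ^ (1 / 2 : ℝ) := Real.mul_rpow hC.le hE₀0.le
          _ ≤ C ^ (1 / 2 : ℝ) * (u ^ 2) ^ (1 / 2 : ℝ) :=
              mul_le_mul_of_nonneg_left (Real.rpow_le_rpow hE₀0.le hE₀u (by norm_num))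
                (Real.rpow_nonneg hC.le _)
          _ = C ^ (1 / 2 : ℝ) * u := by
              rw [← Real.rpow_natCast, ← Real.rpow_mul hu0.le]; norm_num
      have hjunk : Real.log 4 * (z : ℝ) ^ (1 - α) + c₁ ≤
          (Real.log 4 * C ^ (1 / 2 : ℝ) + c₁) * u := by
        have h1 : Real.log 4 * (z : ℝ) ^ (1 - α) ≤ Real.log 4 * (C ^ (1 / 2 : ℝ) * u) :=
          mul_le_mul_of_nonneg_left (le_trans hEhalf hsqrt_le) hl40.le
        have h2 : c₁ * 1 ≤ c₁ * u := mul_le_mul_of_nonneg_left hu1 hc₁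
        linarith
      -- main: `(log 2/2) α ∫ ≥ c₀ (3/5)(3/4) E log y/log E ≥ (9 c₀/20)(c/K) u log y`
      have hmain : 9 * c₀ * c / (20 * K) * (u * Real.log y) ≤
          Real.log 2 / 2 * α * ∫ t in (z : ℝ)..y, t ^ (-α) := by
        rw [← hℓ, ← hc₀]
        have h1 : c / K * u * Real.log y ≤ E / Real.log E * Real.log y :=
          mul_le_mul_of_nonneg_right hfrac hlogy0.le
        calc 9 * c₀ * c / (20 * K) * (u * Real.log y)
            = c₀ * (3 / 5) * (3 / 4 * (c / K * u * Real.log y)) := by field_simp; ring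
          _ ≤ c₀ * (3 / 5) * (3 / 4 * (E / Real.log E * Real.log y)) := by
              refine mul_le_mul_of_nonneg_left (mul_le_mul_of_nonneg_left h1 (by norm_num)) ?_
              positivity
          _ = c₀ * (3 / 5) * (3 / 4 * E * (Real.log y / Real.log E)) := by ring
          _ ≤ c₀ * α * (3 / 4 * E * (Real.log y / Real.log E)) := by
              refine mul_le_mul_of_nonneg_right (mul_le_mul_of_nonneg_left hα35 hc₀0.le) ?_
              have : 0 ≤ Real.log y / Real.log E := by positivity
              positivity
          _ ≤ c₀ * α * ∫ t in (z : ℝ)..y, t ^ (-α) := mul_le_mul_of_nonneg_left hI (by positivity)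
      -- threshold: `(log 4 C^{1/2} + c₁) ≤ (9 c₀ c/(40 K)) log y`
      have hL₂' : 40 * K * (Real.log 4 * C ^ (1 / 2 : ℝ) + c₁) ≤ 9 * c₀ * c * Real.log y := by
        have := (div_le_iff₀ (by positivity : (0 : ℝ) < 9 * c₀ * c)).1 (hL₂.symm.le.trans hlogy_L₂)
        linarith
      have hjunk2 : (Real.log 4 * C ^ (1 / 2 : ℝ) + c₁) * u ≤
          9 * c₀ * c / (40 * K) * (u * Real.log y) := by
        have h1 : Real.log 4 * C ^ (1 / 2 : ℝ) + c₁ ≤ 9 * c₀ * c / (40 * K) * Real.log y := by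
          rw [div_mul_eq_mul_div, le_div_iff₀ (by positivity)]
          linarith
        calc (Real.log 4 * C ^ (1 / 2 : ℝ) + c₁) * u ≤ 9 * c₀ * c / (40 * K) * Real.log y * u :=
              mul_le_mul_of_nonneg_right h1 hu0.le
          _ = 9 * c₀ * c / (40 * K) * (u * Real.log y) := by ring
      have h5 : cD * Real.log x ≤ 9 * c₀ * c / (40 * K) * (u * Real.log y) := by
        rw [← hulogy]
        calc cD * (u * Real.log y) ≤ 9 * c₀ * c / (40 * K) * (u * Real.log y) :=
              mul_le_mul_of_nonneg_right (min_le_right _ _) (by positivity)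
          _ = 9 * c₀ * c / (40 * K) * (u * Real.log y) := rfl
      have h6 : 9 * c₀ * c / (40 * K) * (u * Real.log y) +
          9 * c₀ * c / (40 * K) * (u * Real.log y) =
          9 * c₀ * c / (20 * K) * (u * Real.log y) := by ring
      linarith [hD_ge, hmain, hjunk, hjunk2]
  -- conclusion
  calc cD / 2 * (Real.log x * Real.log y) = Real.log y / 2 * (cD * Real.log x) := by ring
    _ ≤ Real.log y / 2 * D := mul_le_mul_of_nonneg_left hDmain (by positivity)
    _ ≤ saddlePhi₂ α y := hstep1

end Literature.NumberTheory.Sieve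

end
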